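import Summits.QuantumFields.YangMills.Theorems.BalabanUVNodesN11NoExpansionDiagonalCoPHSucc
import Summits.QuantumFields.YangMills.Theorems.BalabanUVNodesN11DiagonalInductionCoPR
import Literature.MathematicalPhysics.QuantumFieldTheory.Balaban1983to89.B16RLeafRecord13LiveGenericZS

/-!
# DAG node N11 — THEOREM 1 OF [III] ALONG THE WHOLE LARGE-FIELD DIAGONAL AT THE v1.7 `CoPH` RECORD (history-indexed residual 𝐓-weights, director-ym LINES №183 H1ʰ ∕
# №186 (α) ∕ №190): for every level `k ≤ K` the post-𝐑 slot of `ρ_k` at the all-large-field (2.18) index of length `k` HAS THE §2 DICHOTOMY — by induction on `k`, each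
# step = dag-n11-d's clause-keyed 𝐓-side step at the v1.7 record (`…NoExpansionDiagonalCoPHSucc`: generic `θ` under the DISPLAYED prefix agreement and generation pins
# on `θ.zhAt p σ_{k+1}`; at the history-blind door of node00-def-K0a's cured family with the pins DISCHARGED) + this seat's Φ-generic clause-level 𝐑-transfer on the live
# line (`…B16RLeafRecord13LiveGenericZS` §0)

Cell `pub-ymgap`, YM-PLAN Track A (HUMAN RULING D-0062), seat `pub-ymgap-dag-n11-e` (g10; R134 fan-out row N11∕s3 «`ThmP245Printed` via `rOperation` from N13's
`ROpLeaf` (pairs with n13-c)»), route `BalabanUVNodes` rev 24∕25 (v1.7 `CoPH` key), helper lane (count-neutral).  [III] = [Balaban1988Convergent], [IV] = [Balaban1989LargeFieldI].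
The v1.7 companion of this seat's `…BalabanUVNodesN11DiagonalInductionCoPR` (p536887).

WHY THIS FILE.  Theorem 1 of [III] (p. 262) is the induction «§2 form of `ρ_k` ⇒ 𝐓-image form of `𝐓ρ_k` (Theorem p. 245) ⇒ §2 form of `ρ_{k+1}` (𝐑, p. 244 ∕ [IV])».
Along the diagonal `σ_k := seqAllLargeOfRecord … k` (`Ω_j = Λ_j = ∅`; `(σ_{k+1}).init = σ_k` is dag-n11-d's `init_seqAllLargeOfRecord`) the two arrows compose level by
level.  At v1.7 the residual 𝐓-weight factor is read PER HISTORY (`θ.zhAt p s`), so at a GENERIC `θ : Stage13HParams` the 𝐓-side step (dag-n11-d's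
`clause_succ_CoPH_of_provisos_of_clause`) carries, per level, the DISPLAYED prefix agreement `hpre` («the old factors agree», director-ym №186 (2): `ζ0_j`, `quad_j` of
`θ.zhAt p σ_{k+1}` and `θ.zhAt p σ_k` agree for `j < k`), `quad_j(∅) = 0` and the generation-`k` pin on def-T's step weight; at the history-blind door of K0a's cured family
`Stage13HParams.ofHistoryBlind (Stage13RParams.ofCured θ₀)` all of them are discharged (`rfl` ∕ `ZrOfRecord₁₃`), and the v1.6 induction (p536887) IS the v1.7 statement there
by `rfl` (def-T's `rzAt_ofHistoryBlind`, `WtOfRecord₁₃H_ofHistoryBlind`).  The 𝐑-side is this seat's `slotClauseΦ_succ_of_slotTClauseΦ_of_liveSel_of_rstep` (arbitrary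
right-hand side, so the history-indexed `sect2Slot … (θ.rzAt p σ) (WtOfRecord₁₃H θ p σ) …` is met by `rfl`).  HENCE:
§1 `diag_slotClause_all_CoPH_of_provisos_of_pins_of_liveSel` — at every `θ : Stage13HParams` with `θ.Provisos₁₃CoPH` (rows `rstep` — the 𝐑-side —, `zetaUnity`, `zhLocal`,
   `measω` — the 𝐓-side), node00-def-T's live-selector clause and `1 ≤ M`, under the DISPLAYED per-level prefix agreements, `quad_j(∅) = 0`, generation pins and
   measurability ∕ uniform bound of the old branch: FOR EVERY `k ≤ K` there are term values `t` and a constant `E` with «`slot_k(σ_k) = 0 ∨ slot_k(σ_k) = 𝐓_k(σ_k)e^{A_k(σ_k)}`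
   `dV_k`-a.e. on `supp χ_k(σ_k)`» at the history's residual `θ.rzAt p σ_k`, weights `WtOfRecord₁₃H θ p σ_k` and def-R's support-edition background.
§2 ★★★ `diag_slotClause_all_doorCured_of_provisosCore_of_liveSel` — AT THE DOOR OF K0a's CURED FAMILY from `θ₀.Provisos₁₃Core` (the K0-class conjunct of the presenting
   parameter) + the selector clause + `1 ≤ M` + the displayed old-branch data ONLY — no pin, no prefix hypothesis: the v1.6 induction read at the door;
   `diag_slotClause_succ_forall_terms_doorCured_of_provisosCore_of_liveSel` — above level 0 for EVERY term-value witness; ★★★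
   `diag_slotClause_all_doorCured_theta13LiveOfRecord_of_provisosCore` — at the cured door of the witness of record from `Provisos₁₃Core` there (+ old-branch data):
   THEOREM 1's INDUCTION ALONG THE LARGE-FIELD DIAGONAL CLOSED IN KERNEL AT A v1.7 WITNESS, both arrows by name at every level.

HONEST FRAMING.  Count-neutral kernel bookkeeping; an induction over two seats' tree theorems; it covers the ONE no-expansion term of (2.18) per level — every sequence
with some `Ω_j ≠ ∅` is [III] Sect. 1 ∕ §3 ∕ Thm 2 proper (the load-bearing content of (S1ᵀ), NOT here); the dichotomy's zero branch is NOT excluded here; at a generic `θ`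
the pins ∕ prefix agreements are DISPLAYED hypotheses on the history's residual (whether print's R-rewritten `ζ` satisfies them off the door is [IV]'s body, unread —
director-ym №186); `hmB ∕ hCB` stay DISPLAYED; nothing of Bałaban asserted; N11 NOT discharged; the K1-class item NOT closed; counts unmoved.  One finite `𝕋⁴_{L^K}`
programme at fixed `ε = L^{−K}`; NOT continuum ∕ OS ∕ mass-gap ∕ Clay.
-/

noncomputable section

open MeasureTheory
open scoped BigOperators Matrix.Norms.L2Operator

namespace Summit.QuantumFields.YangMills.Theorems.BalabanUVNodesN11DiagonalInductionCoPH

open Literature.MathematicalPhysics.QuantumFieldTheory.Balaban1983to89 T4Continuum Node00 Node00.Tk DagBinding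
open Literature.MathematicalPhysics.QuantumFieldTheory.Balaban1983to89.B16RLeafRecord13LiveGenericZS
open Literature.MathematicalPhysics.QuantumFieldTheory.Balaban1983to89.B16RLeafRecord13AtLive (liveRepin₁₃_liveSel)
open BalabanUVNodesN11NoExpansionDiagonalCoPHSucc (clause_succ_CoPH_of_provisos_of_clause)
open BalabanUVNodesN11DiagonalPinAboveZero (init_seqAllLargeOfRecord)
open BalabanUVNodesN11DiagonalInductionCoPR (diag_slotClause_all_ofCured_of_provisosCore_of_liveSel diag_slotClause_succ_forall_terms_ofCured_of_provisosCore_of_liveSel)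

variable {F : T4Family} {N : ℕ} [NeZero N]

/-! ## §1. The induction at a generic `θ : Stage13HParams` from the v1.7 core provisos — prefix agreements and pins on the history's residual displayed -/

section Generic

variable (θ : Stage13HParams F N) (p : B12.RunParams)

/-- **THEOREM 1 ALONG THE LARGE-FIELD DIAGONAL AT THE v1.7 RECORD, GENERIC `θ` — for every `k ≤ K` the post-𝐑 slot of `ρ_k` at the all-large-field index `σ_k` has the §2
dichotomy at the history's residual and weights.**  Hypotheses: `θ.Provisos₁₃CoPH` (rows `rstep` — the 𝐑-side —, `zetaUnity`, `zhLocal`, `measω` — the 𝐓-side), node00-def-T's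
live-selector clause, `1 ≤ M`, and DISPLAYED at every level `k < K`: `quad_j(∅) = 0` of the history's residual `θ.zhAt p σ_{k+1}`, its prefix agreement with `θ.zhAt p σ_k`
below generation `k` (director-ym №186 (2)), the generation-`k` pin on def-T's step weight, and the measurability ∕ uniform bound (constant `C k`) of the old branch
`U ↦ 𝐓_k(σ_k, ∅)e^{A_k(σ_k)}(U)` for every term value and constant.  Induction on `k`: the start is def-T's `sLaw₁₃CoPH_zero` read at `σ_0`; the step is dag-n11-d's
`clause_succ_CoPH_of_provisos_of_clause` (constant carried, `E_{k+1} = E_k`) at `s′ := σ_{k+1}` followed by this seat's Φ-generic `slotClauseΦ_succ_of_slotTClauseΦ_of_liveSel_of_rstep`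
at `θ.toStage13Params`. [cite: Balaban1988Convergent, Thm 1 p.262, Theorem p.245, (3.24)–(3.25) p.270, (2.18) p.257, (2.20)–(2.22) p.258, (1.11) p.248, (3.16)–(3.20) pp.268–269; Balaban1989LargeFieldI, (0.3) p.176, p.177 (i)–(ii)] -/
theorem diag_slotClause_all_CoPH_of_provisos_of_pins_of_liveSel (h : θ.Provisos₁₃CoPH F N)
    (hsel : θ.ppSel = ppSelLiveOfRecord F N θ.ν θ.τ9 (EOfRecord₁₃ F N θ.toStage13Params) (wOfRecord₉ F N θ.toStage9Params)) (hM : 1 ≤ θ.τ9.M)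
    (hq : ∀ k, k < p.K → ∀ (j : ℕ) (ω : MultiCfg (F.P p.K) (SU N) (FluctV N)),
      (θ.zhAt p (seqAllLargeOfRecord F θ.ν θ.τ9.M (gOfRecord₁₃ F N θ.toStage13Params p) p.K (k + 1))).quad j ∅ ω = 0)
    (hpre : ∀ k, k < p.K → ∀ j, j < k →
      (θ.zhAt p (seqAllLargeOfRecord F θ.ν θ.τ9.M (gOfRecord₁₃ F N θ.toStage13Params p) p.K (k + 1))).ζ0 j =
          (θ.zhAt p (seqAllLargeOfRecord F θ.ν θ.τ9.M (gOfRecord₁₃ F N θ.toStage13Params p) p.K k)).ζ0 j ∧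
        (θ.zhAt p (seqAllLargeOfRecord F θ.ν θ.τ9.M (gOfRecord₁₃ F N θ.toStage13Params p) p.K (k + 1))).quad j =
          (θ.zhAt p (seqAllLargeOfRecord F θ.ν θ.τ9.M (gOfRecord₁₃ F N θ.toStage13Params p) p.K k)).quad j)
    (hZ : ∀ k, k < p.K → ∀ (V' : GaugeField (F.P p.K) (k + 1) (SU N)) (U₀ : GaugeField (F.P p.K) k (SU N)),
      (θ.zhAt p (seqAllLargeOfRecord F θ.ν θ.τ9.M (gOfRecord₁₃ F N θ.toStage13Params p) p.K (k + 1))).ζ0 k Set.univ (pairCfgAt (V := FluctV N) k V' U₀) =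
        wOfRecord₉ F N θ.toStage9Params p (gOfRecord₁₃ F N θ.toStage13Params p) k
          (seqAllLargeOfRecord F θ.ν θ.τ9.M (gOfRecord₁₃ F N θ.toStage13Params p) p.K (k + 1)) U₀ ((avOfRecord F N p.K k).avg U₀))
    (C : ℕ → ℝ)
    (hmB : ∀ k, k < p.K → ∀ (t : Sect2.TermValues (F.P p.K) (MatA N) (FluctV N) θ.τ9.M) (E : ℝ),
      Measurable fun U₀ : GaugeField (F.P p.K) k (SU N) =>
        tkBranchOfRecord F N (FluctV N) θ.ν θ.τ9.M _ p.K
          (WtOfRecord₁₃H F N θ p (seqAllLargeOfRecord F θ.ν θ.τ9.M (gOfRecord₁₃ F N θ.toStage13Params p) p.K (k + 1)))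
          (seqAllLargeOfRecord F θ.ν θ.τ9.M (gOfRecord₁₃ F N θ.toStage13Params p) p.K k) (fun _ => ∅) k
          (fun ω => sect2Operand F N (FluctV N) p.K (settingOfRecord₁₃ F N θ.toStage13Params p)
            (θ.rzAt p (seqAllLargeOfRecord F θ.ν θ.τ9.M (gOfRecord₁₃ F N θ.toStage13Params p) p.K k))
            (seqAllLargeOfRecord F θ.ν θ.τ9.M (gOfRecord₁₃ F N θ.toStage13Params p) p.K k) t E
            (UbgOfRecord₁₃CoP F N θ.toStage13Params p k (seqAllLargeOfRecord F θ.ν θ.τ9.M (gOfRecord₁₃ F N θ.toStage13Params p) p.K k))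
            ((fun _ => ∅ : ℕ → Set (Site (F.P p.K) 0)), fun j => (ω j).2) (fun j => (ω j).1))
          (baseCfg (V := FluctV N) k U₀))
    (hCB : ∀ k, k < p.K → ∀ (t : Sect2.TermValues (F.P p.K) (MatA N) (FluctV N) θ.τ9.M) (E : ℝ) (U₀ : GaugeField (F.P p.K) k (SU N)),
      |tkBranchOfRecord F N (FluctV N) θ.ν θ.τ9.M _ p.K
          (WtOfRecord₁₃H F N θ p (seqAllLargeOfRecord F θ.ν θ.τ9.M (gOfRecord₁₃ F N θ.toStage13Params p) p.K (k + 1)))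
          (seqAllLargeOfRecord F θ.ν θ.τ9.M (gOfRecord₁₃ F N θ.toStage13Params p) p.K k) (fun _ => ∅) k
          (fun ω => sect2Operand F N (FluctV N) p.K (settingOfRecord₁₃ F N θ.toStage13Params p)
            (θ.rzAt p (seqAllLargeOfRecord F θ.ν θ.τ9.M (gOfRecord₁₃ F N θ.toStage13Params p) p.K k))
            (seqAllLargeOfRecord F θ.ν θ.τ9.M (gOfRecord₁₃ F N θ.toStage13Params p) p.K k) t E
            (UbgOfRecord₁₃CoP F N θ.toStage13Params p k (seqAllLargeOfRecord F θ.ν θ.τ9.M (gOfRecord₁₃ F N θ.toStage13Params p) p.K k))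
            ((fun _ => ∅ : ℕ → Set (Site (F.P p.K) 0)), fun j => (ω j).2) (fun j => (ω j).1))
          (baseCfg (V := FluctV N) k U₀)| ≤ C k) :
    ∀ k, k ≤ p.K → ∃ (t : Sect2.TermValues (F.P p.K) (MatA N) (FluctV N) θ.τ9.M) (E : ℝ),
      slotsOfRecord F N θ.ν θ.τ9 (EOfRecord₁₃ F N θ.toStage13Params) (wOfRecord₉ F N θ.toStage9Params) θ.ppSel p (gOfRecord₁₃ F N θ.toStage13Params p) k
          (seqAllLargeOfRecord F θ.ν θ.τ9.M (gOfRecord₁₃ F N θ.toStage13Params p) p.K k) = 0 ∨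
        ∀ᵐ U ∂fieldMeasure (F.P p.K) k (SU N),
          chiSeqOfRecord F N θ.ν θ.τ9.M (gOfRecord₁₃ F N θ.toStage13Params p) p.K k (seqAllLargeOfRecord F θ.ν θ.τ9.M (gOfRecord₁₃ F N θ.toStage13Params p) p.K k) U ≠ 0 →
            slotsOfRecord F N θ.ν θ.τ9 (EOfRecord₁₃ F N θ.toStage13Params) (wOfRecord₉ F N θ.toStage9Params) θ.ppSel p (gOfRecord₁₃ F N θ.toStage13Params p) k
                (seqAllLargeOfRecord F θ.ν θ.τ9.M (gOfRecord₁₃ F N θ.toStage13Params p) p.K k) U =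
              sect2Slot F N (FluctV N) p.K (settingOfRecord₁₃ F N θ.toStage13Params p)
                (θ.rzAt p (seqAllLargeOfRecord F θ.ν θ.τ9.M (gOfRecord₁₃ F N θ.toStage13Params p) p.K k))
                (WtOfRecord₁₃H F N θ p (seqAllLargeOfRecord F θ.ν θ.τ9.M (gOfRecord₁₃ F N θ.toStage13Params p) p.K k))
                (seqAllLargeOfRecord F θ.ν θ.τ9.M (gOfRecord₁₃ F N θ.toStage13Params p) p.K k) t E
                (UbgOfRecord₁₃CoP F N θ.toStage13Params p k (seqAllLargeOfRecord F θ.ν θ.τ9.M (gOfRecord₁₃ F N θ.toStage13Params p) p.K k)) U := by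
  intro k
  induction k with
  | zero =>
    intro _
    -- the start: `ρ₀` has the §2 form (def-T's `sLaw₁₃CoPH_zero`), read at the all-large index of length `0`
    obtain ⟨t, Ek, -, hs⟩ := (sLaw₁₃CoPH_iff F N θ p 0).mp (sLaw₁₃CoPH_zero F N θ p)
    exact ⟨t _, Ek _, (hs (seqAllLargeOfRecord F θ.ν θ.τ9.M (gOfRecord₁₃ F N θ.toStage13Params p) p.K 0)).2⟩
  | succ k ih =>
    intro hk1
    have hk : k < p.K := Nat.lt_of_succ_le hk1
    obtain ⟨t₀, E₀, hid⟩ := ih hk.le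
    -- transport the level-`k` data to the old sequence of `σ_{k+1}` (which IS `σ_k`)
    have hinit := init_seqAllLargeOfRecord (F := F) θ.ν θ.τ9.M p (gOfRecord₁₃ F N θ.toStage13Params p) k
    refine ⟨t₀, E₀, ?_⟩
    -- 𝐓-side: dag-n11-d's clause-keyed step at the v1.7 record (prefix agreement, pins, old-branch data displayed), constant carried; 𝐑-side: this seat's transfer
    have hT := clause_succ_CoPH_of_provisos_of_clause θ p h hk hM
      (seqAllLargeOfRecord F θ.ν θ.τ9.M (gOfRecord₁₃ F N θ.toStage13Params p) p.K (k + 1)) (fun j _ _ => rfl) (hq k hk)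
      (by rw [hinit]; exact hpre k hk) t₀ E₀ (by rw [hinit]; exact hid) (hZ k hk)
      (C := C k) (by rw [hinit]; exact hmB k hk t₀ E₀) (by rw [hinit]; exact hCB k hk t₀ E₀) t₀
    exact slotClauseΦ_succ_of_slotTClauseΦ_of_liveSel_of_rstep F N θ.toStage13Params p (fun p k _ hk => h.rstep p k hk) hsel k hk _ _ fun _ => hT

end Generic

/-! ## §2. At the history-blind door of K0a's cured family `Stage13HParams.ofHistoryBlind (Stage13RParams.ofCured θ₀)` from the core provisos of `θ₀` — NO pin hypothesis -/

section DoorCured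

variable (θ₀ : Stage13Params F N) (p : B12.RunParams)

/-- **★★★ THEOREM 1 ALONG THE LARGE-FIELD DIAGONAL AT THE DOOR OF THE CURED FAMILY — for every `k ≤ K` the post-𝐑 slot of `ρ_k` at `σ_k` has the §2 dichotomy at the
door's (history-indexed) residual and weights**, from `θ₀.Provisos₁₃Core`, node00-def-T's live-selector clause of `θ₀`, `1 ≤ M` and the DISPLAYED measurability ∕ uniform
bound of the old branch (NO pin, NO prefix hypothesis: discharged by K0a's `ZrOfRecord₁₃` and `rfl` at the door).  This is this seat's v1.6 induction (p536887,
`…DiagonalInductionCoPR.diag_slotClause_all_ofCured_of_provisosCore_of_liveSel`) READ AT THE DOOR: def-T's `rzAt_ofHistoryBlind` ∕ `WtOfRecord₁₃H_ofHistoryBlind` are `rfl`.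
[cite: Balaban1988Convergent, Thm 1 p.262, Theorem p.245, (3.24)–(3.25) p.270, (2.18) p.257, (1.11) p.248, (3.16)–(3.20) pp.268–269; Balaban1989LargeFieldI, (0.3) p.176, p.177 (i)–(ii)] -/
theorem diag_slotClause_all_doorCured_of_provisosCore_of_liveSel (h : θ₀.Provisos₁₃Core F N)
    (hsel : θ₀.ppSel = ppSelLiveOfRecord F N θ₀.ν θ₀.τ9 (EOfRecord₁₃ F N θ₀) (wOfRecord₉ F N θ₀.toStage9Params)) (hM : 1 ≤ θ₀.τ9.M) (C : ℕ → ℝ)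
    (hmB : ∀ k, k < p.K → ∀ (t : Sect2.TermValues (F.P p.K) (MatA N) (FluctV N) θ₀.τ9.M) (E : ℝ),
      Measurable fun U₀ : GaugeField (F.P p.K) k (SU N) =>
        tkBranchOfRecord F N (FluctV N) θ₀.ν θ₀.τ9.M _ p.K
          (WtOfRecord₁₃H F N (Stage13HParams.ofHistoryBlind F N (Stage13RParams.ofCured F N θ₀)) p
            (seqAllLargeOfRecord F θ₀.ν θ₀.τ9.M (gOfRecord₁₃ F N θ₀ p) p.K k))
          (seqAllLargeOfRecord F θ₀.ν θ₀.τ9.M (gOfRecord₁₃ F N θ₀ p) p.K k) (fun _ => ∅) k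
          (fun ω => sect2Operand F N (FluctV N) p.K (settingOfRecord₁₃ F N θ₀ p)
            ((Stage13HParams.ofHistoryBlind F N (Stage13RParams.ofCured F N θ₀)).rzAt p (seqAllLargeOfRecord F θ₀.ν θ₀.τ9.M (gOfRecord₁₃ F N θ₀ p) p.K k))
            (seqAllLargeOfRecord F θ₀.ν θ₀.τ9.M (gOfRecord₁₃ F N θ₀ p) p.K k) t E
            (UbgOfRecord₁₃CoP F N θ₀ p k (seqAllLargeOfRecord F θ₀.ν θ₀.τ9.M (gOfRecord₁₃ F N θ₀ p) p.K k))
            ((fun _ => ∅ : ℕ → Set (Site (F.P p.K) 0)), fun j => (ω j).2) (fun j => (ω j).1))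
          (baseCfg (V := FluctV N) k U₀))
    (hCB : ∀ k, k < p.K → ∀ (t : Sect2.TermValues (F.P p.K) (MatA N) (FluctV N) θ₀.τ9.M) (E : ℝ) (U₀ : GaugeField (F.P p.K) k (SU N)),
      |tkBranchOfRecord F N (FluctV N) θ₀.ν θ₀.τ9.M _ p.K
          (WtOfRecord₁₃H F N (Stage13HParams.ofHistoryBlind F N (Stage13RParams.ofCured F N θ₀)) p
            (seqAllLargeOfRecord F θ₀.ν θ₀.τ9.M (gOfRecord₁₃ F N θ₀ p) p.K k))
          (seqAllLargeOfRecord F θ₀.ν θ₀.τ9.M (gOfRecord₁₃ F N θ₀ p) p.K k) (fun _ => ∅) k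
          (fun ω => sect2Operand F N (FluctV N) p.K (settingOfRecord₁₃ F N θ₀ p)
            ((Stage13HParams.ofHistoryBlind F N (Stage13RParams.ofCured F N θ₀)).rzAt p (seqAllLargeOfRecord F θ₀.ν θ₀.τ9.M (gOfRecord₁₃ F N θ₀ p) p.K k))
            (seqAllLargeOfRecord F θ₀.ν θ₀.τ9.M (gOfRecord₁₃ F N θ₀ p) p.K k) t E
            (UbgOfRecord₁₃CoP F N θ₀ p k (seqAllLargeOfRecord F θ₀.ν θ₀.τ9.M (gOfRecord₁₃ F N θ₀ p) p.K k))
            ((fun _ => ∅ : ℕ → Set (Site (F.P p.K) 0)), fun j => (ω j).2) (fun j => (ω j).1))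
          (baseCfg (V := FluctV N) k U₀)| ≤ C k) :
    ∀ k, k ≤ p.K → ∃ (t : Sect2.TermValues (F.P p.K) (MatA N) (FluctV N) θ₀.τ9.M) (E : ℝ),
      slotsOfRecord F N θ₀.ν θ₀.τ9 (EOfRecord₁₃ F N θ₀) (wOfRecord₉ F N θ₀.toStage9Params) θ₀.ppSel p (gOfRecord₁₃ F N θ₀ p) k
          (seqAllLargeOfRecord F θ₀.ν θ₀.τ9.M (gOfRecord₁₃ F N θ₀ p) p.K k) = 0 ∨
        ∀ᵐ U ∂fieldMeasure (F.P p.K) k (SU N),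
          chiSeqOfRecord F N θ₀.ν θ₀.τ9.M (gOfRecord₁₃ F N θ₀ p) p.K k (seqAllLargeOfRecord F θ₀.ν θ₀.τ9.M (gOfRecord₁₃ F N θ₀ p) p.K k) U ≠ 0 →
            slotsOfRecord F N θ₀.ν θ₀.τ9 (EOfRecord₁₃ F N θ₀) (wOfRecord₉ F N θ₀.toStage9Params) θ₀.ppSel p (gOfRecord₁₃ F N θ₀ p) k
                (seqAllLargeOfRecord F θ₀.ν θ₀.τ9.M (gOfRecord₁₃ F N θ₀ p) p.K k) U =
              sect2Slot F N (FluctV N) p.K (settingOfRecord₁₃ F N θ₀ p)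
                ((Stage13HParams.ofHistoryBlind F N (Stage13RParams.ofCured F N θ₀)).rzAt p (seqAllLargeOfRecord F θ₀.ν θ₀.τ9.M (gOfRecord₁₃ F N θ₀ p) p.K k))
                (WtOfRecord₁₃H F N (Stage13HParams.ofHistoryBlind F N (Stage13RParams.ofCured F N θ₀)) p
                  (seqAllLargeOfRecord F θ₀.ν θ₀.τ9.M (gOfRecord₁₃ F N θ₀ p) p.K k))
                (seqAllLargeOfRecord F θ₀.ν θ₀.τ9.M (gOfRecord₁₃ F N θ₀ p) p.K k) t E
                (UbgOfRecord₁₃CoP F N θ₀ p k (seqAllLargeOfRecord F θ₀.ν θ₀.τ9.M (gOfRecord₁₃ F N θ₀ p) p.K k)) U :=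
  diag_slotClause_all_ofCured_of_provisosCore_of_liveSel θ₀ p h hsel hM C hmB hCB

/-- **… AND ABOVE LEVEL 0 FOR EVERY TERM-VALUE WITNESS** at the door of the cured family (the diagonal is term-free: dag-n11-d).
[cite: Balaban1988Convergent, Thm 1 p.262, (2.20)–(2.23) p.258, (3.24)–(3.25) p.270; Balaban1989LargeFieldI, (0.3) p.176, p.177 (i)–(ii)] -/
theorem diag_slotClause_succ_forall_terms_doorCured_of_provisosCore_of_liveSel (h : θ₀.Provisos₁₃Core F N)
    (hsel : θ₀.ppSel = ppSelLiveOfRecord F N θ₀.ν θ₀.τ9 (EOfRecord₁₃ F N θ₀) (wOfRecord₉ F N θ₀.toStage9Params)) (hM : 1 ≤ θ₀.τ9.M) (C : ℕ → ℝ)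
    (hmB : ∀ k, k < p.K → ∀ (t : Sect2.TermValues (F.P p.K) (MatA N) (FluctV N) θ₀.τ9.M) (E : ℝ),
      Measurable fun U₀ : GaugeField (F.P p.K) k (SU N) =>
        tkBranchOfRecord F N (FluctV N) θ₀.ν θ₀.τ9.M _ p.K
          (WtOfRecord₁₃H F N (Stage13HParams.ofHistoryBlind F N (Stage13RParams.ofCured F N θ₀)) p
            (seqAllLargeOfRecord F θ₀.ν θ₀.τ9.M (gOfRecord₁₃ F N θ₀ p) p.K k))
          (seqAllLargeOfRecord F θ₀.ν θ₀.τ9.M (gOfRecord₁₃ F N θ₀ p) p.K k) (fun _ => ∅) k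
          (fun ω => sect2Operand F N (FluctV N) p.K (settingOfRecord₁₃ F N θ₀ p)
            ((Stage13HParams.ofHistoryBlind F N (Stage13RParams.ofCured F N θ₀)).rzAt p (seqAllLargeOfRecord F θ₀.ν θ₀.τ9.M (gOfRecord₁₃ F N θ₀ p) p.K k))
            (seqAllLargeOfRecord F θ₀.ν θ₀.τ9.M (gOfRecord₁₃ F N θ₀ p) p.K k) t E
            (UbgOfRecord₁₃CoP F N θ₀ p k (seqAllLargeOfRecord F θ₀.ν θ₀.τ9.M (gOfRecord₁₃ F N θ₀ p) p.K k))
            ((fun _ => ∅ : ℕ → Set (Site (F.P p.K) 0)), fun j => (ω j).2) (fun j => (ω j).1))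
          (baseCfg (V := FluctV N) k U₀))
    (hCB : ∀ k, k < p.K → ∀ (t : Sect2.TermValues (F.P p.K) (MatA N) (FluctV N) θ₀.τ9.M) (E : ℝ) (U₀ : GaugeField (F.P p.K) k (SU N)),
      |tkBranchOfRecord F N (FluctV N) θ₀.ν θ₀.τ9.M _ p.K
          (WtOfRecord₁₃H F N (Stage13HParams.ofHistoryBlind F N (Stage13RParams.ofCured F N θ₀)) p
            (seqAllLargeOfRecord F θ₀.ν θ₀.τ9.M (gOfRecord₁₃ F N θ₀ p) p.K k))
          (seqAllLargeOfRecord F θ₀.ν θ₀.τ9.M (gOfRecord₁₃ F N θ₀ p) p.K k) (fun _ => ∅) k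
          (fun ω => sect2Operand F N (FluctV N) p.K (settingOfRecord₁₃ F N θ₀ p)
            ((Stage13HParams.ofHistoryBlind F N (Stage13RParams.ofCured F N θ₀)).rzAt p (seqAllLargeOfRecord F θ₀.ν θ₀.τ9.M (gOfRecord₁₃ F N θ₀ p) p.K k))
            (seqAllLargeOfRecord F θ₀.ν θ₀.τ9.M (gOfRecord₁₃ F N θ₀ p) p.K k) t E
            (UbgOfRecord₁₃CoP F N θ₀ p k (seqAllLargeOfRecord F θ₀.ν θ₀.τ9.M (gOfRecord₁₃ F N θ₀ p) p.K k))
            ((fun _ => ∅ : ℕ → Set (Site (F.P p.K) 0)), fun j => (ω j).2) (fun j => (ω j).1))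
          (baseCfg (V := FluctV N) k U₀)| ≤ C k)
    (k : ℕ) (hk : k < p.K) (t' : Sect2.TermValues (F.P p.K) (MatA N) (FluctV N) θ₀.τ9.M) :
    ∃ E : ℝ,
      slotsOfRecord F N θ₀.ν θ₀.τ9 (EOfRecord₁₃ F N θ₀) (wOfRecord₉ F N θ₀.toStage9Params) θ₀.ppSel p (gOfRecord₁₃ F N θ₀ p) (k + 1)
          (seqAllLargeOfRecord F θ₀.ν θ₀.τ9.M (gOfRecord₁₃ F N θ₀ p) p.K (k + 1)) = 0 ∨
        ∀ᵐ U ∂fieldMeasure (F.P p.K) (k + 1) (SU N),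
          chiSeqOfRecord F N θ₀.ν θ₀.τ9.M (gOfRecord₁₃ F N θ₀ p) p.K (k + 1) (seqAllLargeOfRecord F θ₀.ν θ₀.τ9.M (gOfRecord₁₃ F N θ₀ p) p.K (k + 1)) U ≠ 0 →
            slotsOfRecord F N θ₀.ν θ₀.τ9 (EOfRecord₁₃ F N θ₀) (wOfRecord₉ F N θ₀.toStage9Params) θ₀.ppSel p (gOfRecord₁₃ F N θ₀ p) (k + 1)
                (seqAllLargeOfRecord F θ₀.ν θ₀.τ9.M (gOfRecord₁₃ F N θ₀ p) p.K (k + 1)) U =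
              sect2Slot F N (FluctV N) p.K (settingOfRecord₁₃ F N θ₀ p)
                ((Stage13HParams.ofHistoryBlind F N (Stage13RParams.ofCured F N θ₀)).rzAt p
                  (seqAllLargeOfRecord F θ₀.ν θ₀.τ9.M (gOfRecord₁₃ F N θ₀ p) p.K (k + 1)))
                (WtOfRecord₁₃H F N (Stage13HParams.ofHistoryBlind F N (Stage13RParams.ofCured F N θ₀)) p
                  (seqAllLargeOfRecord F θ₀.ν θ₀.τ9.M (gOfRecord₁₃ F N θ₀ p) p.K (k + 1)))
                (seqAllLargeOfRecord F θ₀.ν θ₀.τ9.M (gOfRecord₁₃ F N θ₀ p) p.K (k + 1)) t' E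
                (UbgOfRecord₁₃CoP F N θ₀ p (k + 1) (seqAllLargeOfRecord F θ₀.ν θ₀.τ9.M (gOfRecord₁₃ F N θ₀ p) p.K (k + 1))) U :=
  diag_slotClause_succ_forall_terms_ofCured_of_provisosCore_of_liveSel θ₀ p h hsel hM C hmB hCB k hk t'

end DoorCured

/-! ## §3. At the door of the cured witness of record -/

section DoorCuredRecord

variable (F N)
variable (p : B12.RunParams)

/-- **★★★ THEOREM 1 ALONG THE LARGE-FIELD DIAGONAL AT THE DOOR OF K0a's CURED WITNESS OF RECORD `Stage13HParams.ofHistoryBlind (Stage13RParams.ofCured (theta13LiveOfRecord F N))`**: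
from the K0-class conjunct `Provisos₁₃Core` AT THE WITNESS and the displayed old-branch data ONLY (the live-selector clause is K0a's `liveRepin₁₃_liveSel`, `M = 1` by the
family's numerals; no pin, no prefix hypothesis) — for every `k ≤ K`, term values and a constant with the §2 dichotomy of `ρ_k`'s slot at the all-large-field index of
length `k`, at the door's history-indexed residual and weights.
[cite: Balaban1988Convergent, Thm 1 p.262, Theorem p.245, (3.24)–(3.25) p.270, (1.11) p.248, (3.16)–(3.22) pp.268–269; Balaban1989LargeFieldI, (0.3)–(0.4) p.176, p.177 (i)–(ii)] -/
theorem diag_slotClause_all_doorCured_theta13LiveOfRecord_of_provisosCore (h : (theta13LiveOfRecord F N).Provisos₁₃Core F N) (C : ℕ → ℝ)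
    (hmB : ∀ k, k < p.K → ∀ (t : Sect2.TermValues (F.P p.K) (MatA N) (FluctV N) (theta13LiveOfRecord F N).τ9.M) (E : ℝ),
      Measurable fun U₀ : GaugeField (F.P p.K) k (SU N) =>
        tkBranchOfRecord F N (FluctV N) (theta13LiveOfRecord F N).ν (theta13LiveOfRecord F N).τ9.M _ p.K
          (WtOfRecord₁₃H F N (Stage13HParams.ofHistoryBlind F N (Stage13RParams.ofCured F N (theta13LiveOfRecord F N))) p
            (seqAllLargeOfRecord F (theta13LiveOfRecord F N).ν (theta13LiveOfRecord F N).τ9.M (gOfRecord₁₃ F N (theta13LiveOfRecord F N) p) p.K k))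
          (seqAllLargeOfRecord F (theta13LiveOfRecord F N).ν (theta13LiveOfRecord F N).τ9.M (gOfRecord₁₃ F N (theta13LiveOfRecord F N) p) p.K k) (fun _ => ∅) k
          (fun ω => sect2Operand F N (FluctV N) p.K (settingOfRecord₁₃ F N (theta13LiveOfRecord F N) p)
            ((Stage13HParams.ofHistoryBlind F N (Stage13RParams.ofCured F N (theta13LiveOfRecord F N))).rzAt p
              (seqAllLargeOfRecord F (theta13LiveOfRecord F N).ν (theta13LiveOfRecord F N).τ9.M (gOfRecord₁₃ F N (theta13LiveOfRecord F N) p) p.K k))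
            (seqAllLargeOfRecord F (theta13LiveOfRecord F N).ν (theta13LiveOfRecord F N).τ9.M (gOfRecord₁₃ F N (theta13LiveOfRecord F N) p) p.K k) t E
            (UbgOfRecord₁₃CoP F N (theta13LiveOfRecord F N) p k
              (seqAllLargeOfRecord F (theta13LiveOfRecord F N).ν (theta13LiveOfRecord F N).τ9.M (gOfRecord₁₃ F N (theta13LiveOfRecord F N) p) p.K k))
            ((fun _ => ∅ : ℕ → Set (Site (F.P p.K) 0)), fun j => (ω j).2) (fun j => (ω j).1))
          (baseCfg (V := FluctV N) k U₀))
    (hCB : ∀ k, k < p.K → ∀ (t : Sect2.TermValues (F.P p.K) (MatA N) (FluctV N) (theta13LiveOfRecord F N).τ9.M) (E : ℝ) (U₀ : GaugeField (F.P p.K) k (SU N)),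
      |tkBranchOfRecord F N (FluctV N) (theta13LiveOfRecord F N).ν (theta13LiveOfRecord F N).τ9.M _ p.K
          (WtOfRecord₁₃H F N (Stage13HParams.ofHistoryBlind F N (Stage13RParams.ofCured F N (theta13LiveOfRecord F N))) p
            (seqAllLargeOfRecord F (theta13LiveOfRecord F N).ν (theta13LiveOfRecord F N).τ9.M (gOfRecord₁₃ F N (theta13LiveOfRecord F N) p) p.K k))
          (seqAllLargeOfRecord F (theta13LiveOfRecord F N).ν (theta13LiveOfRecord F N).τ9.M (gOfRecord₁₃ F N (theta13LiveOfRecord F N) p) p.K k) (fun _ => ∅) k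
          (fun ω => sect2Operand F N (FluctV N) p.K (settingOfRecord₁₃ F N (theta13LiveOfRecord F N) p)
            ((Stage13HParams.ofHistoryBlind F N (Stage13RParams.ofCured F N (theta13LiveOfRecord F N))).rzAt p
              (seqAllLargeOfRecord F (theta13LiveOfRecord F N).ν (theta13LiveOfRecord F N).τ9.M (gOfRecord₁₃ F N (theta13LiveOfRecord F N) p) p.K k))
            (seqAllLargeOfRecord F (theta13LiveOfRecord F N).ν (theta13LiveOfRecord F N).τ9.M (gOfRecord₁₃ F N (theta13LiveOfRecord F N) p) p.K k) t E
            (UbgOfRecord₁₃CoP F N (theta13LiveOfRecord F N) p k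
              (seqAllLargeOfRecord F (theta13LiveOfRecord F N).ν (theta13LiveOfRecord F N).τ9.M (gOfRecord₁₃ F N (theta13LiveOfRecord F N) p) p.K k))
            ((fun _ => ∅ : ℕ → Set (Site (F.P p.K) 0)), fun j => (ω j).2) (fun j => (ω j).1))
          (baseCfg (V := FluctV N) k U₀)| ≤ C k) :
    ∀ k, k ≤ p.K → ∃ (t : Sect2.TermValues (F.P p.K) (MatA N) (FluctV N) (theta13LiveOfRecord F N).τ9.M) (E : ℝ),
      slotsOfRecord F N (theta13LiveOfRecord F N).ν (theta13LiveOfRecord F N).τ9 (EOfRecord₁₃ F N (theta13LiveOfRecord F N))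
          (wOfRecord₉ F N (theta13LiveOfRecord F N).toStage9Params) (theta13LiveOfRecord F N).ppSel p (gOfRecord₁₃ F N (theta13LiveOfRecord F N) p) k
          (seqAllLargeOfRecord F (theta13LiveOfRecord F N).ν (theta13LiveOfRecord F N).τ9.M (gOfRecord₁₃ F N (theta13LiveOfRecord F N) p) p.K k) = 0 ∨
        ∀ᵐ U ∂fieldMeasure (F.P p.K) k (SU N),
          chiSeqOfRecord F N (theta13LiveOfRecord F N).ν (theta13LiveOfRecord F N).τ9.M (gOfRecord₁₃ F N (theta13LiveOfRecord F N) p) p.K k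
              (seqAllLargeOfRecord F (theta13LiveOfRecord F N).ν (theta13LiveOfRecord F N).τ9.M (gOfRecord₁₃ F N (theta13LiveOfRecord F N) p) p.K k) U ≠ 0 →
            slotsOfRecord F N (theta13LiveOfRecord F N).ν (theta13LiveOfRecord F N).τ9 (EOfRecord₁₃ F N (theta13LiveOfRecord F N))
                (wOfRecord₉ F N (theta13LiveOfRecord F N).toStage9Params) (theta13LiveOfRecord F N).ppSel p (gOfRecord₁₃ F N (theta13LiveOfRecord F N) p) k
                (seqAllLargeOfRecord F (theta13LiveOfRecord F N).ν (theta13LiveOfRecord F N).τ9.M (gOfRecord₁₃ F N (theta13LiveOfRecord F N) p) p.K k) U =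
              sect2Slot F N (FluctV N) p.K (settingOfRecord₁₃ F N (theta13LiveOfRecord F N) p)
                ((Stage13HParams.ofHistoryBlind F N (Stage13RParams.ofCured F N (theta13LiveOfRecord F N))).rzAt p
                  (seqAllLargeOfRecord F (theta13LiveOfRecord F N).ν (theta13LiveOfRecord F N).τ9.M (gOfRecord₁₃ F N (theta13LiveOfRecord F N) p) p.K k))
                (WtOfRecord₁₃H F N (Stage13HParams.ofHistoryBlind F N (Stage13RParams.ofCured F N (theta13LiveOfRecord F N))) p
                  (seqAllLargeOfRecord F (theta13LiveOfRecord F N).ν (theta13LiveOfRecord F N).τ9.M (gOfRecord₁₃ F N (theta13LiveOfRecord F N) p) p.K k))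
                (seqAllLargeOfRecord F (theta13LiveOfRecord F N).ν (theta13LiveOfRecord F N).τ9.M (gOfRecord₁₃ F N (theta13LiveOfRecord F N) p) p.K k) t E
                (UbgOfRecord₁₃CoP F N (theta13LiveOfRecord F N) p k
                  (seqAllLargeOfRecord F (theta13LiveOfRecord F N).ν (theta13LiveOfRecord F N).τ9.M (gOfRecord₁₃ F N (theta13LiveOfRecord F N) p) p.K k)) U :=
  diag_slotClause_all_doorCured_of_provisosCore_of_liveSel (theta13LiveOfRecord F N) p h
    (liveRepin₁₃_liveSel F N (theta13OfFamily F N eps0OfRecord₁₃ _ _ _)) (le_of_eq rfl) C hmB hCB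

end DoorCuredRecord

end Summit.QuantumFields.YangMills.Theorems.BalabanUVNodesN11DiagonalInductionCoPH

end
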